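/-
Copyright (c) 2026 the pub-hodgecm-mathlib formalisation cell (harness21).  Prover seat hodgecm-mathlib-K2E5-p17 (g3) (free E5 hand on the E3 road),
Track B «K2-LIT» ∕ h413 (`stmt-HodgeConjecture-24833`), line `K2_E3_EllipticInputs`, unit U12-d, §L: the ASSEMBLY of the leaf (LBGL-2b)
`sig_K2E3GL2RegularNilpotentFourier` from (b-i) ★ line Fourier inversion and (b-ii) the Borel-slice (Lie–Weyl) density.  2026-09-04.
-/
import Summits.HodgeConjecture.HodgeConjecture.Theorems.K2E3GL2RegularNilpotentFourierLineInversion   -- ★ (b-i) (this seat): `nilpotentAverage_matrixFourier_eq`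
import HarnessLib

/-!
# K2_E3 road (h413), §L — (LBGL-2b) ⟸ (b-ii): `μ̂_reg` is regular as soon as the Borel-slice functional has a Weyl density

Cell `pub/hodgecm-mathlib` (D-0151), Track B, seat K2E5-p17 (g3) (released E5 hand; §L lead K2E3-p12 (g4), dealer K2E3-plan (g2)).  `--supports
stmt-HodgeConjecture-24833 --as helper`; THEOREMS ONLY (no definition ∕ instance ∕ notation ∕ named fact ∕ `sorry`); never imports `Cruxes/…/Lines`.  COUNT-NEUTRAL:
(L-B_GL) :478 of U12 stays OPEN; (LBGL-2b) is paid only when (b-ii) lands (K2E5-p10 (g4), `Theorems/K2E3GL2BorelSliceLieWeyl.lean`, default 2026-09-04T02:59Z).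

THE ASSEMBLY.  The leaf (LBGL-2b) (U12 ED. 8 :378 = `hB` of ★ p856788) asks for `F_reg` locally integrable, locally constant on `{disc χ ≠ 0}`, with
`|disc χ|^{1/2}·|F_reg|` locally bounded, and `μ_reg(𝓕_ψ f) = ∫ f·F_reg dμ𝔤` on `C_c^∞(𝔤𝔩₂(F))`.  By ★ (b-i) `nilpotentAverage_matrixFourier_eq`
(`μ_reg(𝓕_ψ f) = c · Λ(f)`, `Λ(f) = ∫_K ∫_{F³} f(k [[r₀,r₁],[0,r₂]] k⁻¹) dr dκ`, `c > 0`) it suffices that the BOREL-SLICE FUNCTIONAL `Λ` has a density `W` with the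
same three regularity properties — this is (b-ii), the Lie-algebra Weyl integration formula for the split Cartan of `𝔤𝔩₂` (`W = c′·|disc χ|^{-1/2}·1_{split r.s.}`;
★ p856597 `K2E3GL2DiscrInvSqrtLocallyIntegrable` supplies `|disc|^{-1/2} ∈ L¹_loc`) — and then `F_reg := c · W`:
* **`gl2RegularNilpotentFourier_of_sliceDensity`** — `(∃ W, L¹_loc ∧ Λ(f) = ∫ f·W ∧ loc. const on {disc ≠ 0} ∧ |disc|^{1/2}‖W‖ loc. bdd) → ‹the four clauses of
  (LBGL-2b) for (F, ψ, μ𝔤, κ, dx)›`, for every finite-on-compacts `κ` on `GL₂(𝒪)` (in particular the Haar `κ` of the socket) and additive Haar `dx`, `μ𝔤`.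
* **`gl2RegularNilpotentFourier_of_forall_sliceDensity`** — the same in the SOCKET'S SHAPE: `‹(b-ii) ∀-quantified in the socket's binder order› → ‹socket :378 body, TOKEN
  FOR TOKEN›` (`F : Type`, `[CharZero F]`, Haar `κ`); the socket's by-name payer is this theorem applied to the (b-ii) head.

References: [HarishChandra1999AdmissibleDistributions] Harish-Chandra (DeBacker–Sally), AMS ULECT 16 (1999), Thm. 4.4 p. 11, Lemma 7.8 · [Howe1974] R. Howe, Math. Ann.
208 (1974), §2 Prop. 3.
HONEST LABEL: HC_CM is proved only modulo the 7 printed citations (2 remaining named inputs: hLiu418 = stmt-HodgeConjecture-24832, h413 = stmt-HodgeConjecture-24833)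
until rung 0 closes; count-neutral conditional helper ((LBGL-2b) modulo (b-ii)).
-/

set_option autoImplicit false
set_option linter.dupNamespace false   -- `Summit.HodgeConjecture.HodgeConjecture.…` (D-0017 nested layout; lakefile exemption for Summits)

noncomputable section

open MeasureTheory Measure Filter Topology
open scoped MatrixGroups NNReal ENNReal
open Literature.NumberTheory.Rogawski1990 Literature.NumberTheory.Automorphic Literature.NumberTheory.Automorphic.LocalFieldHaar
open Literature.NumberTheory.GaloisRepresentations Literature.NumberTheory.GaloisRepresentations.IsNonarchimedeanLocalField
open Summit.HodgeConjecture.HodgeConjecture.Cruxes.H413.K2E3GL2RegularNilpotentFourierLineInversion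

namespace Summit.HodgeConjecture.HodgeConjecture.Cruxes.H413.K2E3GL2RegularNilpotentFourierOfSliceDensity

variable {F : Type*} [Field F] [ValuativeRel F] [TopologicalSpace F] [IsNonarchimedeanLocalField F]
variable [MeasurableSpace F] [BorelSpace F] [MeasurableSpace (GL (Fin 2) F)] [BorelSpace (GL (Fin 2) F)]
  [MeasurableSpace (Matrix (Fin 2) (Fin 2) F)] [BorelSpace (Matrix (Fin 2) (Fin 2) F)]

/-- **(LBGL-2b) ⟸ (b-ii) — regularity of `μ̂_reg` from a Weyl density of the Borel-slice functional.**  If the functional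
`Λ(f) = ∫_K ∫_{F³} f(k [[r₀,r₁],[0,r₂]] k⁻¹) dx^{⊗3} dκ` is represented by a locally integrable `W`, locally constant on `{disc χ ≠ 0}` and with `|disc χ|^{1/2}·‖W‖`
locally bounded, then `F_reg := c · W` (`c > 0` the line-inversion constant of ★ `nilpotentAverage_matrixFourier_eq`) is locally integrable, represents
`μ_reg ∘ 𝓕_ψ` — `∫_{K×F} (𝓕_ψ f)(k (tE₁₂) k⁻¹) d(κ ⊗ dx) = ∫ f · F_reg dμ𝔤` for `f ∈ C_c^∞(𝔤𝔩₂(F))` —, is locally constant on `{disc χ ≠ 0}` and has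
`|disc χ|^{1/2}·‖F_reg‖` locally bounded: the four clauses of the leaf (LBGL-2b) for the data `(F, ψ, μ𝔤, κ, dx)`.
[cite: HarishChandra1999AdmissibleDistributions, Thm. 4.4 p. 11, Lemma 7.8] [cite: Howe1974, §2 Prop. 3] -/
theorem gl2RegularNilpotentFourier_of_sliceDensity (ψ : AddChar F Circle) (hψ : ψ.IsContinuousNontrivial)
    (μ𝔤 : Measure (Matrix (Fin 2) (Fin 2) F)) [μ𝔤.IsAddHaarMeasure]
    (κ : Measure ↥(glInt 2 F)) [IsFiniteMeasureOnCompacts κ] (dx : Measure F) [dx.IsAddHaarMeasure]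
    (hW : ∃ W : Matrix (Fin 2) (Fin 2) F → ℂ, LocallyIntegrable W μ𝔤 ∧
      (∀ f : Matrix (Fin 2) (Fin 2) F → ℂ, IsLocSmooth f →
        ∫ k : ↥(glInt 2 F), ∫ r : Fin 3 → F,
            f (((k : GL (Fin 2) F) : Matrix (Fin 2) (Fin 2) F) * !![r 0, r 1; 0, r 2] * ((((k : GL (Fin 2) F))⁻¹ : GL (Fin 2) F) : Matrix (Fin 2) (Fin 2) F))
            ∂(Measure.pi fun _ : Fin 3 => dx) ∂κ =
          ∫ X, f X * W X ∂μ𝔤) ∧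
      (∀ X : Matrix (Fin 2) (Fin 2) F, IsUnit X.charpoly.discr → ∀ᶠ Y in 𝓝 X, W Y = W X) ∧
      (∀ C : Set (Matrix (Fin 2) (Fin 2) F), IsCompact C → ∃ B : ℝ, ∀ X ∈ C,
          ((NNReal.sqrt (normAbs F X.charpoly.discr) : ℝ≥0) : ℝ) * ‖W X‖ ≤ B)) :
    ∃ Fr : Matrix (Fin 2) (Fin 2) F → ℂ, LocallyIntegrable Fr μ𝔤 ∧
      (∀ f : Matrix (Fin 2) (Fin 2) F → ℂ, IsLocSmooth f →
        ∫ p : ↥(glInt 2 F) × F, (fun Y : Matrix (Fin 2) (Fin 2) F => ∫ X, ((ψ (Matrix.trace (Y * X)) : Circle) : ℂ) * f X ∂μ𝔤)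
            (((p.1 : GL (Fin 2) F) : Matrix (Fin 2) (Fin 2) F) * !![0, p.2; 0, 0] * ((((p.1 : GL (Fin 2) F))⁻¹ : GL (Fin 2) F) : Matrix (Fin 2) (Fin 2) F)) ∂(κ.prod dx) =
          ∫ X, f X * Fr X ∂μ𝔤) ∧
      (∀ X : Matrix (Fin 2) (Fin 2) F, IsUnit X.charpoly.discr → ∀ᶠ Y in 𝓝 X, Fr Y = Fr X) ∧
      (∀ C : Set (Matrix (Fin 2) (Fin 2) F), IsCompact C → ∃ B : ℝ, ∀ X ∈ C,
          ((NNReal.sqrt (normAbs F X.charpoly.discr) : ℝ≥0) : ℝ) * ‖Fr X‖ ≤ B) := by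
  obtain ⟨c, hc, hline⟩ := nilpotentAverage_matrixFourier_eq ψ hψ μ𝔤 κ dx
  obtain ⟨W, hW_int, hW_rep, hW_lc, hW_bd⟩ := hW
  refine ⟨fun X => (c : ℂ) * W X, ?_, ?_, ?_, ?_⟩
  · -- local integrability of `c · W`
    simpa only [Pi.smul_def, smul_eq_mul] using hW_int.smul (c : ℂ)
  · -- the representation `μ_reg(𝓕_ψ f) = ∫ f · (c · W)`
    intro f hf
    rw [hline f hf, hW_rep f hf, ← integral_const_mul]
    refine integral_congr_ae (Filter.Eventually.of_forall fun X => ?_)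
    simp only
    ring
  · -- local constancy on the regular semisimple set
    intro X hX
    exact (hW_lc X hX).mono fun Y hY => by simp only [hY]
  · -- `|disc|^{1/2}·‖c · W‖` is locally bounded
    intro C hC
    obtain ⟨B, hB⟩ := hW_bd C hC
    refine ⟨c * B, fun X hX => ?_⟩
    have hD0 : 0 ≤ ((NNReal.sqrt (normAbs F X.charpoly.discr) : ℝ≥0) : ℝ) := NNReal.coe_nonneg _
    rw [norm_mul, Complex.norm_real, Real.norm_eq_abs, abs_of_pos hc]
    calc ((NNReal.sqrt (normAbs F X.charpoly.discr) : ℝ≥0) : ℝ) * (c * ‖W X‖)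
        = c * (((NNReal.sqrt (normAbs F X.charpoly.discr) : ℝ≥0) : ℝ) * ‖W X‖) := by ring
      _ ≤ c * B := mul_le_mul_of_nonneg_left (hB X hX) hc.le

/-- **THE SOCKET SHAPE — (LBGL-2b) `sig_K2E3GL2RegularNilpotentFourier` (U12 ED. 8) MODULO (b-ii).**  Hypothesis = the Borel-slice density statement (b-ii)
universally quantified in the socket's own binder order (`F : Type`, `[CharZero F]`, `ψ`, `μ𝔤`, the Borel instances, a HAAR `κ` on `GL₂(𝒪)`, `dx`); conclusion = the
socket's body TOKEN FOR TOKEN.  The by-name payer of the socket is this theorem applied to the (b-ii) head (K2E5-p10 (g4), `K2E3GL2BorelSliceDensity.exists_borelSliceDensity`).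
[cite: HarishChandra1999AdmissibleDistributions, Thm. 4.4 p. 11, Lemma 7.8] [cite: Howe1974, §2 Prop. 3] -/
theorem gl2RegularNilpotentFourier_of_forall_sliceDensity
    (hW : ∀ (F : Type) [Field F] [ValuativeRel F] [TopologicalSpace F] [IsNonarchimedeanLocalField F] [CharZero F]
      (ψ : AddChar F Circle), ψ.IsContinuousNontrivial →
      ∀ [MeasurableSpace (Matrix (Fin 2) (Fin 2) F)] [BorelSpace (Matrix (Fin 2) (Fin 2) F)] (μ𝔤 : Measure (Matrix (Fin 2) (Fin 2) F)) [μ𝔤.IsAddHaarMeasure]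
        [MeasurableSpace F] [BorelSpace F] [MeasurableSpace (GL (Fin 2) F)] [BorelSpace (GL (Fin 2) F)]
        (κ : Measure ↥(glInt 2 F)) [IsHaarMeasure κ] (dx : Measure F) [dx.IsAddHaarMeasure],
      ∃ W : Matrix (Fin 2) (Fin 2) F → ℂ, LocallyIntegrable W μ𝔤 ∧
        (∀ f : Matrix (Fin 2) (Fin 2) F → ℂ, IsLocSmooth f →
          ∫ k : ↥(glInt 2 F), ∫ r : Fin 3 → F,
              f (((k : GL (Fin 2) F) : Matrix (Fin 2) (Fin 2) F) * !![r 0, r 1; 0, r 2] * ((((k : GL (Fin 2) F))⁻¹ : GL (Fin 2) F) : Matrix (Fin 2) (Fin 2) F))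
              ∂(Measure.pi fun _ : Fin 3 => dx) ∂κ =
            ∫ X, f X * W X ∂μ𝔤) ∧
        (∀ X : Matrix (Fin 2) (Fin 2) F, IsUnit X.charpoly.discr → ∀ᶠ Y in 𝓝 X, W Y = W X) ∧
        (∀ C : Set (Matrix (Fin 2) (Fin 2) F), IsCompact C → ∃ B : ℝ, ∀ X ∈ C,
            ((NNReal.sqrt (normAbs F X.charpoly.discr) : ℝ≥0) : ℝ) * ‖W X‖ ≤ B)) :
    ∀ (F : Type) [Field F] [ValuativeRel F] [TopologicalSpace F] [IsNonarchimedeanLocalField F] [CharZero F]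
      (ψ : AddChar F Circle), ψ.IsContinuousNontrivial →
      ∀ [MeasurableSpace (Matrix (Fin 2) (Fin 2) F)] [BorelSpace (Matrix (Fin 2) (Fin 2) F)] (μ𝔤 : Measure (Matrix (Fin 2) (Fin 2) F)) [μ𝔤.IsAddHaarMeasure]
        [MeasurableSpace F] [BorelSpace F] [MeasurableSpace (GL (Fin 2) F)] [BorelSpace (GL (Fin 2) F)]
        (κ : Measure ↥(glInt 2 F)) [IsHaarMeasure κ] (dx : Measure F) [dx.IsAddHaarMeasure],
      ∃ Fr : Matrix (Fin 2) (Fin 2) F → ℂ, LocallyIntegrable Fr μ𝔤 ∧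
        (∀ f : Matrix (Fin 2) (Fin 2) F → ℂ, IsLocSmooth f →
          ∫ p : ↥(glInt 2 F) × F, (fun Y : Matrix (Fin 2) (Fin 2) F => ∫ X, ((ψ (Matrix.trace (Y * X)) : Circle) : ℂ) * f X ∂μ𝔤)
              (((p.1 : GL (Fin 2) F) : Matrix (Fin 2) (Fin 2) F) * !![0, p.2; 0, 0] * ((((p.1 : GL (Fin 2) F))⁻¹ : GL (Fin 2) F) : Matrix (Fin 2) (Fin 2) F)) ∂(κ.prod dx) =
            ∫ X, f X * Fr X ∂μ𝔤) ∧
        (∀ X : Matrix (Fin 2) (Fin 2) F, IsUnit X.charpoly.discr → ∀ᶠ Y in 𝓝 X, Fr Y = Fr X) ∧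
        (∀ C : Set (Matrix (Fin 2) (Fin 2) F), IsCompact C → ∃ B : ℝ, ∀ X ∈ C,
            ((NNReal.sqrt (normAbs F X.charpoly.discr) : ℝ≥0) : ℝ) * ‖Fr X‖ ≤ B) := by
  intro F _ _ _ _ _ ψ hψ _ _ μ𝔤 _ _ _ _ _ κ _ dx _
  exact gl2RegularNilpotentFourier_of_sliceDensity ψ hψ μ𝔤 κ dx (hW F ψ hψ μ𝔤 κ dx)

end Summit.HodgeConjecture.HodgeConjecture.Cruxes.H413.K2E3GL2RegularNilpotentFourierOfSliceDensity

end
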